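import Summits.Parity.GeneralizedHardyLittlewood.Theorems.LeeYangFibresCellParityLawModelDensityBounds
import Literature.NumberTheory.Sieve.RoughOmegaCellsLocalAP
import Literature.NumberTheory.Sieve.RoughOmegaCellsClassesEquidistribution
import Literature.NumberTheory.Sieve.RoughOmegaCellsAsymptoticDensity
import Literature.NumberTheory.Sieve.RoughOmegaCellsProgressionSegment
import Literature.NumberTheory.Sieve.LinearEquationsInPrimesOneForm
import Literature.NumberTheory.Sieve.LinearEquationsInPrimesDimOne
import HarnessLib

/-!
# Route `LeeYangFibres`, crux `CellParityLaw` (stmt-Parity-14109), line `section-annihilator`: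
# the registered stub `stub_base` — the effective cell-parity law for ONE form

We prove `LawEffAt 1` (vocabulary file `LeeYangFibresCellParityLawDefs`): for one affine form
`ψ(n) = a n + b` (`a ≠ 0`, `|a| + |b|/N ≤ L`) on a convex `K ⊆ [-N, N] ⊆ ℝ¹` the rough `Ω`-cells
`C_j = #{n ∈ K ∩ ℤ : P⁻(ψ(n)) > N^{1/u}, Ω(ψ(n)) = j}` satisfy, for every `B` and all large `N`,
`|C_j − W_θ(j) · β_∞ · 𝔖 · a_j| ≤ N/(log N (log log N)^B)` with the TRIVIAL Walsh amplitudes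
`θ_∅ = 1`, `θ_S = 0` otherwise (so `W_θ ≡ 1`): the Landau–Alladi law for one progression segment.

The proof assembles Literature theorems:

* `K ∩ {ψ > 0}` is an interval of `ℝ`; its integer points form an integer interval `[m₁, m₂]` whose
  length is `β_∞ = vol(K ∩ {ψ > 0})` up to `1` (`LinearEquationsInPrimesDimOne.lean`);
* `𝔖(ψ) = 𝟙_{gcd(a,b)=1} |a|/φ(|a|)` (`LinearEquationsInPrimesOneForm.lean`); for `gcd(a, b) > 1`
  no value is rough and both sides vanish (`RoughCellsSegment.card_filter_Icc_eq_zero_of_dvd`);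
* the values `a m + b`, `m ∈ [m₁, m₂]`, form an AP segment to the modulus `|a| ≤ L`, on which the
  rough `Ω = j` numbers obey the LOCAL LAW at scale `N`
  (`RoughCellsLocal.exists_forall_abs_cellClass_segment_sub_le`, fed with Alladi's asymptotic
  `exists_abs_roughCell_sub_main_le` and the equidistribution in reduced classes
  `RoughCellsAP.exists_abs_cellClassDisc_le`, which rests on the tree's Bombieri–Vinogradov
  theorem), packaged as `RoughCellsSegment.abs_card_segment_sub_le`;
* `a_j = A_j(N)/N` with `A_j(N)` the `Ω = j` cell of `roughIcc (⌊N^{1/u}⌋ + 1) N`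
  (`modelDensity_eq_card_div`, file `…ModelDensityBounds`).
-/

noncomputable section

open scoped BigOperators Classical ArithmeticFunction.Omega
open Finset Filter MeasureTheory Literature.NumberTheory.Sieve

namespace Summit.Parity.GeneralizedHardyLittlewood.Cruxes.CellParityLaw.SectionAnnihilator

namespace BaseAux

/-! ## The data of one form -/

/-- From `‖Ψ‖_N ≤ L` (`N ≥ 1`), for `ψ = Ψ 0 = a n + b`: `|a| ≤ L` and `|a| N + |b| ≤ L N`. -/
theorem coeff_bounds {Ψ : Fin 1 → AffLinForm 1} {N L : ℕ} (hN : 0 < N) (h : affLinSize Ψ N ≤ L) :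
    ((Ψ 0).coeff 0).natAbs ≤ L ∧
      (((Ψ 0).coeff 0).natAbs : ℝ) * N + |((Ψ 0).const : ℝ)| ≤ L * N := by
  unfold affLinSize at h
  simp only [Fin.sum_univ_one] at h
  have hN' : (0 : ℝ) < N := by exact_mod_cast hN
  rw [abs_div, abs_of_pos hN'] at h
  have h1 : 0 ≤ |((Ψ 0).const : ℝ)| / N := by positivity
  have hcast : (((Ψ 0).coeff 0).natAbs : ℝ) = |(((Ψ 0).coeff 0 : ℤ) : ℝ)| := by
    rw [Nat.cast_natAbs, Int.cast_abs]
  constructor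
  · have : (((Ψ 0).coeff 0).natAbs : ℝ) ≤ L := by rw [hcast]; linarith
    exact_mod_cast this
  · rw [hcast]
    have h2 := mul_le_mul_of_nonneg_right h hN'.le
    rw [add_mul, div_mul_cancel₀ _ hN'.ne'] at h2
    exact h2

/-- A value `a m + b` with `|m| ≤ N` is at most `|a| N + |b|`. -/
theorem value_le {a b m : ℤ} {N L : ℕ} (hm : -(N : ℤ) ≤ m ∧ m ≤ N)
    (h : ((a.natAbs : ℝ)) * N + |(b : ℝ)| ≤ L * N) : a * m + b ≤ L * N := by
  have h1 : ((a * m + b : ℤ) : ℝ) ≤ (a.natAbs : ℝ) * N + |(b : ℝ)| := by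
    push_cast
    have hmR : |(m : ℝ)| ≤ N := by
      rw [abs_le]; constructor <;> exact_mod_cast (by omega : _)
    have ha : ((a : ℝ)) * m ≤ |(a : ℝ)| * N := by
      calc (a : ℝ) * m ≤ |(a : ℝ) * m| := le_abs_self _
        _ = |(a : ℝ)| * |(m : ℝ)| := abs_mul _ _
        _ ≤ |(a : ℝ)| * N := mul_le_mul_of_nonneg_left hmR (abs_nonneg _)
    rw [Nat.cast_natAbs, Int.cast_abs]
    linarith [le_abs_self (b : ℝ)]
  exact_mod_cast h1.trans h

/-- The cell of the one-form system as a count over the integers `m ∈ [-N, N]`. -/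
theorem cell_eq_card_filter (Ψ : Fin 1 → AffLinForm 1) (K : Set (Fin 1 → ℝ)) (N u j₀ : ℕ) :
    cell Ψ K N u (fun _ => j₀) = #((Finset.Icc (-(N : ℤ)) N).filter (fun m : ℤ =>
      (fun _ : Fin 1 => ((m : ℤ) : ℝ)) ∈ K ∧
        ((N : ℝ) ^ ((1 : ℝ) / u) < (Nat.minFac ((Ψ 0).coeff 0 * m + (Ψ 0).const).toNat : ℝ) ∧
          Ω ((Ψ 0).coeff 0 * m + (Ψ 0).const).toNat = j₀))) := by
  unfold cell
  rw [DimOne.card_filter_latticeBox]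
  congr 1
  refine Finset.filter_congr fun m _ => ?_
  simp only [Fin.forall_fin_one, DimOne.eval_eq, DimOne.realPoint_const]

/-- The archimedean factor of the one-form system is the length of the slice `K ∩ {a r + b > 0}`. -/
theorem archFactor_eq_volume (Ψ : Fin 1 → AffLinForm 1) (K : Set (Fin 1 → ℝ)) :
    archFactor Ψ K = (volume {r : ℝ | (fun _ : Fin 1 => r) ∈ K ∧
      0 < (((Ψ 0).coeff 0 : ℤ) : ℝ) * r + ((Ψ 0).const : ℝ)}).toReal := by
  rw [DimOne.archFactor_eq]
  congr 2
  ext r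
  simp only [Set.mem_setOf_eq, Fin.forall_fin_one, DimOne.realEval_eq]

/-! ## The law for one cell index -/

/-- **The effective law for one form and one cell index** `1 ≤ j₀ ≤ u`: for `N ≥ N₀(L, u, B)`,
`|C_{j₀} − β_∞ 𝔖 a_{j₀}| ≤ N/(log N (log log N)^B)` uniformly over non-degenerate one-form systems of
size `≤ L` and convex `K ⊆ [-N, N]`. -/
theorem cell_law (L u B : ℕ) (hu : 2 ≤ u) (hL : 1 ≤ L) :
    ∃ N₀ : ℕ, ∀ N : ℕ, N₀ ≤ N → ∀ Ψ : Fin 1 → AffLinForm 1, IsNondegenerateSystem Ψ →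
      affLinSize Ψ N ≤ L → ∀ K : Set (Fin 1 → ℝ), Convex ℝ K → K ⊆ realBox 1 N →
      ∀ j₀ : ℕ, 1 ≤ j₀ → j₀ ≤ u →
        |(cell Ψ K N u (fun _ => j₀) : ℝ) - archFactor Ψ K * singularProduct Ψ * modelDensity N u j₀| ≤
          (N : ℝ) / (Real.log N * Real.log (Real.log N) ^ B) := by
  -- the local law for every cell index `i + 1`, with exponent `B + 1`
  have hloc : ∀ i : ℕ, ∃ N₀ : ℕ, ∀ N : ℕ, N₀ ≤ N → ∀ q : ℕ, 0 < q → q ≤ L → ∀ r : ℕ, r.Coprime q →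
      ∀ V₁ V₂ : ℕ, V₁ ≤ V₂ → V₂ ≤ L * N →
        |(#((roughIcc (⌊(N : ℝ) ^ ((1 : ℝ) / u)⌋₊ + 1) V₂).filter
              (fun v => Ω v = i + 1 ∧ v ≡ r [MOD q])) : ℝ) -
            #((roughIcc (⌊(N : ℝ) ^ ((1 : ℝ) / u)⌋₊ + 1) V₁).filter
              (fun v => Ω v = i + 1 ∧ v ≡ r [MOD q])) -
            ((V₂ : ℝ) - V₁) / Nat.totient q *
              ((#((roughIcc (⌊(N : ℝ) ^ ((1 : ℝ) / u)⌋₊ + 1) N).filter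
                (fun v => Ω v = i + 1)) : ℝ) / N)| ≤
          (N : ℝ) / (Real.log N * Real.log (Real.log N) ^ (B + 1)) := by
    intro i
    obtain ⟨C₁, hC₁, hP1⟩ := exists_abs_roughCell_sub_main_le i (u + 1)
    refine RoughCellsLocal.exists_forall_abs_cellClass_segment_sub_le L (B + 1) hu hL hC₁ hP1 ?_
    intro q hq _
    obtain ⟨C, hC, h⟩ := RoughCellsAP.exists_abs_cellClassDisc_le q hq (u + 1)
    exact ⟨C, hC, fun X Y hY hYX hXY hqY c hc => h X Y hY hYX hXY hqY i c hc⟩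
  choose Nloc hNloc using hloc
  -- growth conditions on `N`
  have hu0 : (0 : ℝ) < 1 / u := by
    have : (0 : ℝ) < u := by exact_mod_cast (by omega : 0 < u)
    positivity
  have hev1 : ∀ᶠ N : ℕ in atTop, (2 * L + 2 : ℝ) ≤ (N : ℝ) ^ ((1 : ℝ) / u) :=
    ((tendsto_rpow_atTop hu0).comp tendsto_natCast_atTop_atTop).eventually_ge_atTop _
  have hev4 : ∀ᶠ N : ℕ in atTop, (2 : ℝ) ≤ Real.log (Real.log N) :=
    ((Real.tendsto_log_atTop.comp Real.tendsto_log_atTop).comp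
      tendsto_natCast_atTop_atTop).eventually_ge_atTop 2
  obtain ⟨N₁, hN₁⟩ := Filter.eventually_atTop.1 (hev1.and
    ((RoughCellsLocal.eventually_rpow_le_div_log_sq hu).and
      ((RoughCellsLocal.eventually_mul_loglog_pow_le_log 1 B).and (hev4.and (eventually_ge_atTop 3)))))
  refine ⟨max N₁ ((Finset.range u).sup Nloc), fun N hN Ψ hΨ hsize K hK hKN j₀ hj₀ hj₀u => ?_⟩
  obtain ⟨hLz, hzN, hllB, hll2, hN3⟩ := hN₁ N (le_trans (le_max_left _ _) hN)
  rw [one_mul] at hllB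
  obtain ⟨i, rfl⟩ : ∃ i, j₀ = i + 1 := ⟨j₀ - 1, by omega⟩
  have hiu : i < u := by omega
  have hNi : Nloc i ≤ N :=
    le_trans ((Finset.le_sup (Finset.mem_range.mpr hiu)).trans (le_max_right _ _)) hN
  have hlocN := hNloc i N hNi
  -- notation and basic facts
  set a : ℤ := (Ψ 0).coeff 0 with ha
  set b : ℤ := (Ψ 0).const with hb
  set z : ℝ := (N : ℝ) ^ ((1 : ℝ) / u) with hz
  set E : ℝ := (N : ℝ) / (Real.log N * Real.log (Real.log N) ^ (B + 1)) with hE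
  set R : ℝ := (N : ℝ) / (Real.log N * Real.log (Real.log N) ^ B) with hR
  have hN0 : 0 < N := by omega
  have hN0' : (0 : ℝ) < N := by exact_mod_cast hN0
  have hlogN : 1 < Real.log N := by
    rw [Real.lt_log_iff_exp_lt hN0']
    have h3 : (3 : ℝ) ≤ N := by exact_mod_cast hN3
    linarith [Real.exp_one_lt_d9]
  have hlog0 : 0 < Real.log N := by linarith
  have hll0 : 0 < Real.log (Real.log N) := by linarith
  have hR0 : 0 ≤ R := by positivity
  have hE0 : 0 ≤ E := by positivity
  have hER : 2 * E ≤ R := by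
    have e : R = E * Real.log (Real.log N) := by
      rw [hE, hR, pow_succ]; field_simp
    rw [e]; nlinarith
  have hRbig : (4 * L + 4 : ℝ) ≤ R := by
    have h1 : (N : ℝ) / Real.log N ^ 2 ≤ R := by
      rw [hR, sq]
      exact div_le_div_of_nonneg_left hN0'.le (by positivity)
        (mul_le_mul_of_nonneg_left hllB hlog0.le)
    linarith
  have ha0 : a ≠ 0 := by
    intro h0
    apply hΨ.1 0
    funext k
    rw [Fin.fin_one_eq_zero k]
    exact h0
  obtain ⟨haL, habL⟩ := coeff_bounds hN0 hsize
  have hL0 : (0 : ℝ) ≤ L := Nat.cast_nonneg L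
  have hz2 : 2 ≤ z := by linarith
  have haLR : (a.natAbs : ℝ) ≤ L := by exact_mod_cast haL
  have haz : (a.natAbs : ℝ) < z := by linarith
  -- the model density is `A/N`
  rw [modelDensity_eq_card_div (by omega : 1 ≤ i + 1)]
  set A : ℝ := (#((roughIcc (⌊z⌋₊ + 1) N).filter (fun v => Ω v = i + 1)) : ℝ) with hA
  have hA1 : A / N ≤ 1 := by
    rw [div_le_one hN0', hA]
    exact_mod_cast card_roughIcc_filter_cardFactors_le _ N (i + 1)
  have hA0 : 0 ≤ A / N := by positivity
  -- Case 1: a local obstruction `gcd(a, b) > 1`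
  by_cases hg : Int.gcd a b ≠ 1
  · have hS : singularProduct Ψ = 0 := by
      rw [OneForm.singularProduct_eq Ψ ha0, if_neg hg]
    have hg0 : Int.gcd a b ≠ 0 := fun h => ha0 (Int.gcd_eq_zero_iff.mp h).1
    have hga : Int.gcd a b ≤ a.natAbs := Nat.gcd_le_left _ (Int.natAbs_pos.mpr ha0)
    have hcell : cell Ψ K N u (fun _ => i + 1) = 0 := by
      rw [cell_eq_card_filter, ← Finset.filter_filter]
      exact RoughCellsSegment.card_filter_Icc_eq_zero_of_dvd (g := Int.gcd a b) (by omega)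
        (Int.gcd_dvd_left a b) (Int.gcd_dvd_right a b)
        (lt_of_le_of_lt (by exact_mod_cast hga) haz) hz2 _ (fun _ v => Ω v = i + 1)
    rw [hcell, hS]
    simpa using hR0
  push Not at hg
  -- Case 2: `gcd(a, b) = 1`, `𝔖 = |a|/φ(|a|)`
  have hS : singularProduct Ψ = (a.natAbs : ℝ) / Nat.totient a.natAbs := by
    rw [OneForm.singularProduct_eq Ψ ha0, if_pos hg]
  have hq0 : 0 < a.natAbs := Int.natAbs_pos.mpr ha0
  have hφ1 : (1 : ℝ) ≤ Nat.totient a.natAbs := by exact_mod_cast Nat.totient_pos.mpr hq0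
  have hqφ : (a.natAbs : ℝ) / Nat.totient a.natAbs ≤ L := (div_le_self (Nat.cast_nonneg _) hφ1).trans haLR
  have hqφ0 : 0 ≤ (a.natAbs : ℝ) / Nat.totient a.natAbs := by positivity
  -- the slice `S = K ∩ {ψ > 0}` and its integer points
  set S : Set ℝ := {r : ℝ | (fun _ : Fin 1 => r) ∈ K ∧ 0 < (a : ℝ) * r + b} with hSdef
  have hSoc : S.OrdConnected :=
    ((DimOne.convex_slice hK).inter (DimOne.convex_setOf_pos (a : ℝ) b)).ordConnected
  have hSN : S ⊆ Set.Icc (-(N : ℝ)) N := by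
    intro r hr
    have h := hKN hr.1
    simp only [realBox, Set.mem_Icc, Pi.le_def] at h
    exact ⟨h.1 0, h.2 0⟩
  obtain ⟨m₁, m₂, hI, hvol⟩ := DimOne.exists_filter_eq_Icc hSoc hSN
  have hvol0 : 0 ≤ (volume S).toReal := ENNReal.toReal_nonneg
  have harch : archFactor Ψ K = (volume S).toReal := archFactor_eq_volume Ψ K
  have hcellI : (cell Ψ K N u (fun _ => i + 1) : ℝ) = #((Finset.Icc m₁ m₂).filter (fun m =>
      z < (Nat.minFac (a * m + b).toNat : ℝ) ∧ Ω (a * m + b).toNat = i + 1)) := by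
    rw [cell_eq_card_filter, ← hI, Finset.filter_filter]
    congr 2
    refine Finset.filter_congr fun m _ => ?_
    simp only [hSdef, Set.mem_setOf_eq]
    constructor
    · rintro ⟨hK', hlt, hΩ⟩
      refine ⟨⟨hK', ?_⟩, hlt, hΩ⟩
      by_contra hle
      push Not at hle
      have hle' : a * m + b ≤ 0 := by exact_mod_cast hle
      rw [Int.toNat_of_nonpos hle', Nat.minFac_zero, Nat.cast_ofNat] at hlt
      have hlt' : (N : ℝ) ^ ((1 : ℝ) / u) < 2 := hlt
      rw [← hz] at hlt'
      linarith
    · rintro ⟨⟨hK', -⟩, hlt, hΩ⟩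
      exact ⟨hK', hlt, hΩ⟩
  have hmemI : ∀ m : ℤ, m ∈ Finset.Icc m₁ m₂ → 0 < a * m + b ∧ (-(N : ℤ) ≤ m ∧ m ≤ N) := by
    intro m hm
    rw [← hI, Finset.mem_filter, Finset.mem_Icc] at hm
    have h := hm.2.2
    exact ⟨by exact_mod_cast h, hm.1⟩
  rw [hcellI, harch, hS]
  -- Case 2a: no integer point
  rcases lt_or_ge m₂ m₁ with hemp | hm12
  · rw [Finset.Icc_eq_empty_of_lt hemp, Finset.filter_empty, Finset.card_empty, Nat.cast_zero,
      zero_sub, abs_neg]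
    rw [Finset.Icc_eq_empty_of_lt hemp, Finset.card_empty, Nat.cast_zero, zero_sub, abs_neg] at hvol
    have hv1 : (volume S).toReal ≤ 1 := (le_abs_self _).trans hvol
    rw [abs_of_nonneg (by positivity)]
    calc (volume S).toReal * ((a.natAbs : ℝ) / Nat.totient a.natAbs) * (A / N) ≤ 1 * L * 1 := by
          gcongr
      _ ≤ R := by linarith
  -- Case 2b: the segment law for the sign-normalised progression
  have hcard : (#(Finset.Icc m₁ m₂) : ℝ) = (m₂ : ℝ) - m₁ + 1 := by
    have e : (((m₂ + 1 - m₁).toNat : ℕ) : ℝ) = ((m₂ + 1 - m₁ : ℤ) : ℝ) := by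
      exact_mod_cast Int.toNat_of_nonneg (by omega)
    rw [Int.card_Icc, e]; push_cast; ring
  rw [hcard] at hvol
  have hfin : ∀ (a' m₁' m₂' : ℤ), 0 < a' → a'.natAbs = a.natAbs → m₁' ≤ m₂' → Int.gcd a' b = 1 →
      0 < a' * m₁' + b → a' * m₂' + b ≤ L * N → (m₂' : ℝ) - m₁' = m₂ - m₁ →
      (#((Finset.Icc m₁ m₂).filter (fun m => z < (Nat.minFac (a * m + b).toNat : ℝ) ∧
          Ω (a * m + b).toNat = i + 1)) : ℝ) =
        #((Finset.Icc m₁' m₂').filter (fun m => z < (Nat.minFac (a' * m + b).toNat : ℝ) ∧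
          Ω (a' * m + b).toNat = i + 1)) →
      |(#((Finset.Icc m₁ m₂).filter (fun m => z < (Nat.minFac (a * m + b).toNat : ℝ) ∧
          Ω (a * m + b).toNat = i + 1)) : ℝ) -
        (volume S).toReal * ((a.natAbs : ℝ) / Nat.totient a.natAbs) * (A / N)| ≤ R := by
    intro a' m₁' m₂' ha' hnat hm' hgcd' hpos' hV' hlen hcount
    have hq : a'.toNat = a.natAbs := by
      rw [← hnat]
      exact Int.natCast_inj.mp (by rw [Int.toNat_of_nonneg ha'.le, Int.natAbs_of_nonneg ha'.le])
    have h := RoughCellsSegment.abs_card_segment_sub_le (u := u) (i := i) (E := E) ha' hm' hpos' hV'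
      hgcd' (hq ▸ haL) hlocN
    rw [← hcount, hq, hlen] at h
    simp only [← hz] at h
    -- from `q (m₂ − m₁ + 1)` to `q · vol S`
    set q : ℝ := (a.natAbs : ℝ) with hqdef
    set φq : ℝ := (Nat.totient a.natAbs : ℝ) with hφq
    have hφ0 : 0 < φq := by linarith
    have e : (#((Finset.Icc m₁ m₂).filter (fun m => z < (Nat.minFac (a * m + b).toNat : ℝ) ∧
          Ω (a * m + b).toNat = i + 1)) : ℝ) - (volume S).toReal * (q / φq) * (A / N) =
        ((#((Finset.Icc m₁ m₂).filter (fun m => z < (Nat.minFac (a * m + b).toNat : ℝ) ∧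
          Ω (a * m + b).toNat = i + 1)) : ℝ) - q * ((m₂ : ℝ) - m₁ + 1) / φq * (A / N)) +
        (q / φq) * (A / N) * (((m₂ : ℝ) - m₁ + 1) - (volume S).toReal) := by ring
    rw [e]
    refine (abs_add_le _ _).trans ?_
    have h2 : |(q / φq) * (A / N) * (((m₂ : ℝ) - m₁ + 1) - (volume S).toReal)| ≤ L := by
      rw [abs_mul, abs_of_nonneg (by positivity)]
      calc q / φq * (A / N) * |((m₂ : ℝ) - m₁ + 1) - (volume S).toReal| ≤ L * 1 * 1 :=
            mul_le_mul (mul_le_mul hqφ hA1 hA0 hL0) hvol (abs_nonneg _) (by positivity)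
        _ = L := by ring
    linarith [h2, h]
  rcases lt_or_gt_of_ne ha0 with hneg | hpos
  · -- `a < 0`: reflect `m ↦ -m`
    refine hfin (-a) (-m₂) (-m₁) (by omega) (Int.natAbs_neg a) (by omega) (by rwa [Int.neg_gcd])
      ?_ ?_ (by push_cast; ring) ?_
    · have := (hmemI m₂ (Finset.mem_Icc.mpr ⟨hm12, le_rfl⟩)).1; linarith
    · have h := value_le (hmemI m₁ (Finset.mem_Icc.mpr ⟨le_rfl, hm12⟩)).2 habL
      linarith
    · exact_mod_cast DimOne.card_filter_Icc_neg a b m₁ m₂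
        (fun v => z < (Nat.minFac v.toNat : ℝ) ∧ Ω v.toNat = i + 1)
  · exact hfin a m₁ m₂ hpos rfl hm12 hg (hmemI m₁ (Finset.mem_Icc.mpr ⟨le_rfl, hm12⟩)).1
      (value_le (hmemI m₂ (Finset.mem_Icc.mpr ⟨hm12, le_rfl⟩)).2 habL) rfl rfl

end BaseAux

/-! ## The registered stub -/

/-- **`stub_base`** (registered stub of the line `section-annihilator`): the effective cell-parity
law `LawEffAt 1` for ONE affine form — with the Walsh amplitudes `θ_∅ = 1`, `θ_S = 0` (`S ≠ ∅`) the
amplitude factor is `1`, and the law is the local law for the rough `Ω`-cells of one progression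
segment (`BaseAux.cell_law`). -/
theorem stub_base : LawEffAt 1 := by
  intro L u B hu
  rcases Nat.lt_or_ge L 1 with hL | hL
  · -- `L = 0`: no form of size `≤ 0` is non-degenerate
    refine ⟨0, fun N _ Ψ hΨ hsize K _ _ => ?_⟩
    exfalso
    apply hΨ.1 0
    have h : affLinSize Ψ N ≤ 0 := by
      have : (L : ℝ) = 0 := by exact_mod_cast (by omega : L = 0)
      rw [this] at hsize; exact hsize
    unfold affLinSize at h
    simp only [Fin.sum_univ_one] at h
    have h1 : |(((Ψ 0).coeff 0 : ℤ) : ℝ)| ≤ 0 := by linarith [abs_nonneg (((Ψ 0).const : ℝ) / N)]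
    have h2 : (Ψ 0).coeff 0 = 0 := by exact_mod_cast abs_nonpos_iff.mp h1
    funext k; rw [Fin.fin_one_eq_zero k]; exact h2
  obtain ⟨N₀, hN₀⟩ := BaseAux.cell_law L u B hu hL
  refine ⟨N₀, fun N hN Ψ hΨ hsize K hK hKN => ⟨fun S => if S = ∅ then 1 else 0, if_pos rfl, ?_, ?_⟩⟩
  · intro S; dsimp only; split_ifs <;> norm_num
  · intro j hj
    have hw : walsh (fun S : Finset (Fin 1) => if S = ∅ then (1 : ℝ) else 0) j = 1 := by
      unfold walsh
      rw [Finset.sum_eq_single_of_mem (∅ : Finset (Fin 1)) (Finset.mem_univ _)]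
      · simp
      · intro S _ hS; simp [hS]
    have hj' : j = fun _ => j 0 := by funext k; rw [Fin.fin_one_eq_zero k]
    rw [hw, one_mul, Fin.prod_univ_one, hj', pow_one]
    exact hN₀ N hN Ψ hΨ hsize K hK hKN (j 0) (hj 0).1 (hj 0).2

end Summit.Parity.GeneralizedHardyLittlewood.Cruxes.CellParityLaw.SectionAnnihilator

end
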